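import Literature.Probability.LatticeModels.DiscreteFaceBoundary
import Literature.Probability.Percolation.InterfaceScalingLimitDiscretised
import Literature.Probability.RandomPlanarGeometry.ChordalReversibility
import HarnessLib

/-!
# The oriented polygonal Dobrushin domains of a bond-percolation discretisation family

Topic `Literature/Probability/Percolation` (family `crit-perc`/`crit-ising`). For a
square-lattice discretisation family `(Ω_δ; a_δ, b_δ) = Λ δ` of a Dobrushin domain `(D; a, b)`
(`LatticeModels.ZdDiscretisationFamily D Λ`) and an admissible mesh `δ`,
`DiscreteFaceBoundary.lean` constructs the polygonal Dobrushin domain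
`DiscreteDobrushin.faceDomain` — "the polygonal domain `Ω^δ_ℂ` (union of tiles) corresponding to
`Ω^δ`" of Chelkak–Duminil-Copin–Hongler–Kemppainen–Smirnov (C. R. Math. 352 (2014), §2) — marked
at the midpoints of the two `A`–`B` edges `e_a` (start of G02's exploration, arc `A` on its
left) and `e_b`, and proves that the medial exploration polyline of EVERY configuration runs in
its closure from `pt 0` to `pt 1`. The tree's bond interface `bondInterfaceIn D (Λ δ)`
(`InterfaceScalingLimitDiscretised.lean`) is that polyline RE-ORIENTED by the endpoint rule
`orientCurve D` (kept if its start is at least as close to `a` as to `b`, reversed otherwise),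
because `MarkedDomain` does not orient the boundary loop. This file makes the matching choice of
marks:

* `familyFaceDomain hΛ hadm` — `faceDomain` of the datum `Λ δ`, its four regularity inputs
  (`Ω` open, exterior connected, unbounded, `∂Ω ⊆` closure of the exterior) being those of the
  Jordan carrier `D` (`DiscreteDobrushin.regular_of_eq_carrier`);
* `orientedFaceDomain hΛ hadm` — the same Jordan domain with the marks swapped
  (`MarkedDomain.swap`) exactly when `orientCurve` reverses the polyline, so that
  **the bond interface of every configuration is the class of a curve running in the closed
  oriented face domain from its `pt 0` to its `pt 1`** (`orientCurve_medialExplorationCurve_apply_zero/one`,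
  `range_orientCurve_medialExplorationCurve_subset`, `bondInterfaceIn_eq_mk_orientCurve`);
* the inputs (B) (`exists_forall_orientedFaceDomain_subset_ball`) and (K2)
  (`not_ball_subset_orientedFaceDomain`) of Pommerenke's kernel convergence theorem
  (`RandomPlanarGeometry/KernelConvergenceULC.lean`, `MarkedDomain.exists_uniformizers_of_kernel(_of_isChordalUniformizing)`)
  for these domains, from `DiscreteFaceBoundary.lean`;
* **`tendsto_pt_orientedFaceDomain`** — along positive admissible meshes `δ_k → 0` the marked
  points of the oriented face domains converge: `pt 0 → a` and `pt 1 → b` (the family axiom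
  `tendsto_zdABEdges` gives Hausdorff convergence of `{a_δ, b_δ}` to `{a, b}` only as SETS; the
  orientation rule and `a ≠ b` sort the two points) — the inputs `ha`, `hb` of the kernel theorem
  and of Kemppainen–Smirnov's theorem in approximating domains
  (`ae_isLoewnerDescribable_and_tendstoInDistribution_drivingPath_varying`, KS Cor. 1.8).

Everything is proved. NOT here (absent from the tree): the remaining kernel inputs (K1)
(compacts of `D` eventually inside the face domains) and (ULC) (uniform local connectedness of
their complements), and the Loewner describability / Kemppainen–Smirnov regularity of the
(non-simple) exploration polyline in these domains.

## References

* D. Chelkak, H. Duminil-Copin, C. Hongler, A. Kemppainen, S. Smirnov, C. R. Math. Acad. Sci.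
  Paris 352 (2014) 157–161, §2–3. [CDHKSCRAS2014]
* A. Kemppainen, S. Smirnov, Ann. Probab. 45 (2017) 698–779, §1.1 and Cor. 1.8.
  [KemppainenSmirnov2017]
* S. Smirnov, C. R. Acad. Sci. Paris 333 (2001), §2 (the discrete Dobrushin set-up). [Smirnov2001]
* F. Camia, C. M. Newman, Probab. Theory Related Fields 139 (2007), §2 (the exploration path
  from `a_δ` to `b_δ`). [CamiaNewman2007]
-/

noncomputable section

open Set Filter Metric
open _root_.Topology
open scoped unitInterval ENNReal
open Literature.Probability.LatticeModels Literature.Probability.RandomPlanarGeometry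

namespace Literature.Probability.Percolation

variable {D : DobrushinDomain} {Λ : ℝ → DiscreteDobrushin}

/-! ### The face domains of a discretisation family -/

/-- The domain of every datum of a discretisation family of the Jordan domain `D` is REGULAR in
the sense of `DiscreteFaceBoundary.lean`: open, with connected unbounded exterior and
`∂Ω ⊆ closure (closure Ω)ᶜ` (the Jordan curve theorem, `DiscreteDobrushin.regular_of_eq_carrier`).
[folklore] -/
theorem regular_of_zdDiscretisationFamily (hΛ : ZdDiscretisationFamily D Λ) (δ : ℝ) :
    IsOpen (Λ δ).Ω ∧ IsConnected (closure (Λ δ).Ω)ᶜ ∧ ¬ Bornology.IsBounded (closure (Λ δ).Ω)ᶜ ∧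
      frontier (Λ δ).Ω ⊆ closure (closure (Λ δ).Ω)ᶜ :=
  DiscreteDobrushin.regular_of_eq_carrier (D := Λ δ) D.toJordanDomain (hΛ.Ω_eq δ)

/-- **The polygonal Dobrushin domain of the datum `Λ δ` of a discretisation family** (admissible
mesh `δ`): `DiscreteDobrushin.faceDomain` with the regularity inputs of
`regular_of_zdDiscretisationFamily`; marked at the midpoints of `e_a` (`pt 0`) and `e_b`
(`pt 1`) in the orientation of G02's exploration (arc `A` on the left). (CDHKS 2014, §2: the
polygonal domain `Ω^δ_ℂ` with its marked points.) [cite: CDHKSCRAS2014, §2] -/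
def familyFaceDomain (hΛ : ZdDiscretisationFamily D Λ) {δ : ℝ} (hadm : (Λ δ).IsZdAdmissible) :
    DobrushinDomain :=
  DiscreteDobrushin.faceDomain hadm (regular_of_zdDiscretisationFamily hΛ δ).1
    (regular_of_zdDiscretisationFamily hΛ δ).2.1 (regular_of_zdDiscretisationFamily hΛ δ).2.2.1
    (regular_of_zdDiscretisationFamily hΛ δ).2.2.2

open scoped Classical in
/-- **The oriented polygonal Dobrushin domain of the datum `Λ δ`**: `familyFaceDomain` when the
start `a_δ = pt 0` of the exploration is at least as close to `a` as to `b` (the test of the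
endpoint rule `orientCurve D` applied to the exploration polyline, which starts at `a_δ`), and
`familyFaceDomain` with its two marks swapped (`MarkedDomain.swap`) otherwise — so that the
re-oriented interface `bondInterfaceIn D (Λ δ)` always runs from `pt 0` to `pt 1` of this
domain. (Camia–Newman 2007, §2: the exploration path from `a_δ` to `b_δ`; CDHKS 2014, §2.)
[cite: CDHKSCRAS2014, §2] -/
def orientedFaceDomain (hΛ : ZdDiscretisationFamily D Λ) {δ : ℝ} (hadm : (Λ δ).IsZdAdmissible) :
    DobrushinDomain :=
  if dist ((familyFaceDomain hΛ hadm).pt 0) (D.pt 0) ≤ dist ((familyFaceDomain hΛ hadm).pt 0) (D.pt 1)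
  then familyFaceDomain hΛ hadm else (familyFaceDomain hΛ hadm).swap

section OneMesh

variable (hΛ : ZdDiscretisationFamily D Λ) {δ : ℝ} (hadm : (Λ δ).IsZdAdmissible)

/-- In the first case of the endpoint rule the oriented face domain is the face domain.
[folklore] -/
theorem orientedFaceDomain_of_le
    (h : dist ((familyFaceDomain hΛ hadm).pt 0) (D.pt 0) ≤
      dist ((familyFaceDomain hΛ hadm).pt 0) (D.pt 1)) :
    orientedFaceDomain hΛ hadm = familyFaceDomain hΛ hadm := by
  classical
  exact if_pos h

/-- In the second case of the endpoint rule the oriented face domain is the swapped face domain.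
[folklore] -/
theorem orientedFaceDomain_of_not_le
    (h : ¬ dist ((familyFaceDomain hΛ hadm).pt 0) (D.pt 0) ≤
      dist ((familyFaceDomain hΛ hadm).pt 0) (D.pt 1)) :
    orientedFaceDomain hΛ hadm = (familyFaceDomain hΛ hadm).swap := by
  classical
  exact if_neg h

/-- Orientation does not change the carrier. [folklore] -/
@[simp] theorem carrier_orientedFaceDomain :
    (orientedFaceDomain hΛ hadm).carrier = (familyFaceDomain hΛ hadm).carrier := by
  by_cases h : dist ((familyFaceDomain hΛ hadm).pt 0) (D.pt 0) ≤
      dist ((familyFaceDomain hΛ hadm).pt 0) (D.pt 1)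
  · rw [orientedFaceDomain_of_le hΛ hadm h]
  · rw [orientedFaceDomain_of_not_le hΛ hadm h]
    rfl

/-- The marked points of the oriented face domain are those of the face domain, in one order or
the other. [folklore] -/
theorem pt_orientedFaceDomain_eq_or :
    ((orientedFaceDomain hΛ hadm).pt 0 = (familyFaceDomain hΛ hadm).pt 0 ∧
        (orientedFaceDomain hΛ hadm).pt 1 = (familyFaceDomain hΛ hadm).pt 1) ∨
      ((orientedFaceDomain hΛ hadm).pt 0 = (familyFaceDomain hΛ hadm).pt 1 ∧
        (orientedFaceDomain hΛ hadm).pt 1 = (familyFaceDomain hΛ hadm).pt 0) := by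
  by_cases h : dist ((familyFaceDomain hΛ hadm).pt 0) (D.pt 0) ≤
      dist ((familyFaceDomain hΛ hadm).pt 0) (D.pt 1)
  · exact Or.inl ⟨by rw [orientedFaceDomain_of_le hΛ hadm h], by rw [orientedFaceDomain_of_le hΛ hadm h]⟩
  · refine Or.inr ⟨?_, ?_⟩
    · rw [orientedFaceDomain_of_not_le hΛ hadm h, MarkedDomain.pt_swap_zero]
    · rw [orientedFaceDomain_of_not_le hΛ hadm h, MarkedDomain.pt_swap_one]

/-- The exploration polyline of the datum starts at `pt 0` of the (unoriented) face domain.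
[cite: CDHKSCRAS2014, §2] -/
theorem medialExplorationCurve_apply_zero_eq (ω : BondConfig (Site 2)) :
    medialExplorationCurve (Λ δ) ω 0 = (familyFaceDomain hΛ hadm).pt 0 :=
  DiscreteDobrushin.medialExplorationCurve_apply_zero hadm _ _ _ _ ω

/-- The exploration polyline of the datum ends at `pt 1` of the (unoriented) face domain.
[cite: CDHKSCRAS2014, §2] -/
theorem medialExplorationCurve_apply_one_eq (ω : BondConfig (Site 2)) :
    medialExplorationCurve (Λ δ) ω 1 = (familyFaceDomain hΛ hadm).pt 1 :=
  DiscreteDobrushin.medialExplorationCurve_apply_one hadm _ _ _ _ ω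

/-- **The re-oriented exploration polyline starts at `pt 0` of the oriented face domain.**
(Camia–Newman 2007, §2; CDHKS 2014, §2.) [cite: CDHKSCRAS2014, §2] -/
theorem orientCurve_medialExplorationCurve_apply_zero (ω : BondConfig (Site 2)) :
    orientCurve D (medialExplorationCurve (Λ δ) ω) 0 = (orientedFaceDomain hΛ hadm).pt 0 := by
  have h0 := medialExplorationCurve_apply_zero_eq hΛ hadm ω
  by_cases h : dist ((familyFaceDomain hΛ hadm).pt 0) (D.pt 0) ≤
      dist ((familyFaceDomain hΛ hadm).pt 0) (D.pt 1)
  · rw [orientedFaceDomain_of_le hΛ hadm h, orientCurve_of_le D (by rwa [h0]), ← h0]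
    rfl
  · rw [orientedFaceDomain_of_not_le hΛ hadm h, MarkedDomain.pt_swap_zero,
      orientCurve_of_lt D (by rw [h0]; exact lt_of_not_ge h),
      ← medialExplorationCurve_apply_one_eq hΛ hadm ω]
    show medialExplorationCurve (Λ δ) ω (unitInterval.symm 0) = _
    rw [unitInterval.symm_zero]

/-- **The re-oriented exploration polyline ends at `pt 1` of the oriented face domain.**
(Camia–Newman 2007, §2; CDHKS 2014, §2.) [cite: CDHKSCRAS2014, §2] -/
theorem orientCurve_medialExplorationCurve_apply_one (ω : BondConfig (Site 2)) :
    orientCurve D (medialExplorationCurve (Λ δ) ω) 1 = (orientedFaceDomain hΛ hadm).pt 1 := by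
  have h0 := medialExplorationCurve_apply_zero_eq hΛ hadm ω
  by_cases h : dist ((familyFaceDomain hΛ hadm).pt 0) (D.pt 0) ≤
      dist ((familyFaceDomain hΛ hadm).pt 0) (D.pt 1)
  · rw [orientedFaceDomain_of_le hΛ hadm h, orientCurve_of_le D (by rwa [h0]),
      ← medialExplorationCurve_apply_one_eq hΛ hadm ω]
    rfl
  · rw [orientedFaceDomain_of_not_le hΛ hadm h, MarkedDomain.pt_swap_one,
      orientCurve_of_lt D (by rw [h0]; exact lt_of_not_ge h), ← h0]
    show medialExplorationCurve (Λ δ) ω (unitInterval.symm 1) = _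
    rw [unitInterval.symm_one]

/-- **The re-oriented exploration polyline runs in the closed oriented face domain.**
(CDHKS 2014, §2.) [cite: CDHKSCRAS2014, §2] -/
theorem range_orientCurve_medialExplorationCurve_subset (ω : BondConfig (Site 2)) :
    (orientCurve D (medialExplorationCurve (Λ δ) ω)).range ⊆
      closure (orientedFaceDomain hΛ hadm).carrier := by
  rw [range_orientCurve, carrier_orientedFaceDomain]
  exact DiscreteDobrushin.range_medialExplorationCurve_subset hadm _ _ _ _ ω

/-- The bond interface is the class of the re-oriented exploration polyline (unfolding).
[cite: Smirnov2007ICM, §2.1] -/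
theorem bondInterfaceIn_eq_mk_orientCurve (ω : BondConfig (Site 2)) :
    bondInterfaceIn D (Λ δ) ω = CurveClass.mk (orientCurve D (medialExplorationCurve (Λ δ) ω)) :=
  rfl

/-- **The bond interface of every configuration is the class of a curve running in the closed
oriented face domain from `pt 0` to `pt 1`** — the compatibility of the tree's interface with
the approximating domains required to read it through their uniformizing maps (KS 2017, §1.1:
curves in `X_simple(U, a, b)`-position, up to simplicity). [cite: KemppainenSmirnov2017, §1.1] -/
theorem exists_curve_bondInterfaceIn (ω : BondConfig (Site 2)) :
    ∃ c : Curve ℂ, CurveClass.mk c = bondInterfaceIn D (Λ δ) ω ∧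
      c 0 = (orientedFaceDomain hΛ hadm).pt 0 ∧ c 1 = (orientedFaceDomain hΛ hadm).pt 1 ∧
      c.range ⊆ closure (orientedFaceDomain hΛ hadm).carrier :=
  ⟨_, rfl, orientCurve_medialExplorationCurve_apply_zero hΛ hadm ω,
    orientCurve_medialExplorationCurve_apply_one hΛ hadm ω,
    range_orientCurve_medialExplorationCurve_subset hΛ hadm ω⟩

/-- (K2) for the oriented face domains: no disc about a point off `D` lies in any of them (they
lie in `closure D`, `DiscreteDobrushin.not_ball_subset_faceDomain`). [cite: PommerenkeBBCM1992, §1.4] -/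
theorem not_ball_subset_orientedFaceDomain {w : ℂ} (hw : w ∉ D.carrier) {r : ℝ} (hr : 0 < r) :
    ¬ ball w r ⊆ (orientedFaceDomain hΛ hadm).carrier := by
  rw [carrier_orientedFaceDomain]
  have hw' : w ∉ (Λ δ).Ω := by rwa [hΛ.Ω_eq]
  exact DiscreteDobrushin.not_ball_subset_faceDomain hadm _ _ _ _ hw' hr

/-- The oriented face domains lie in `closure D`. [cite: CDHKSCRAS2014, §2] -/
theorem orientedFaceDomain_carrier_subset_closure :
    (orientedFaceDomain hΛ hadm).carrier ⊆ closure D.carrier := by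
  rw [carrier_orientedFaceDomain, ← hΛ.Ω_eq δ]
  exact DiscreteDobrushin.faceDomain_carrier_subset_closure hadm _ _ _ _

end OneMesh

/-- (B) for the oriented face domains: ONE disc contains all of them (they lie in `closure D`,
which is bounded). [cite: PommerenkeBBCM1992, §1.4] -/
theorem exists_forall_orientedFaceDomain_subset_ball (hΛ : ZdDiscretisationFamily D Λ) :
    ∃ R > 0, ∀ {δ : ℝ} (hadm : (Λ δ).IsZdAdmissible), (orientedFaceDomain hΛ hadm).carrier ⊆ ball 0 R := by
  obtain ⟨R, hR⟩ := D.isBounded.closure.subset_ball_lt 0 (0 : ℝ)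
  exact ⟨R, hR.1, fun hadm ↦ (orientedFaceDomain_carrier_subset_closure hΛ hadm).trans hR.2⟩

/-! ### Convergence of the marked points along a sequence of meshes -/

/-- The set of discrete marked points of an admissible datum consists of the two marked points
of its face domain: `medialPoint δ '' zdABEdges = {pt 0, pt 1}` (there are exactly two `A`–`B`
edges, `e_a` and `e_b`). [cite: Smirnov2001, §2] -/
theorem medialPoint_image_zdABEdges_eq (hΛ : ZdDiscretisationFamily D Λ) {δ : ℝ}
    (hadm : (Λ δ).IsZdAdmissible) :
    medialPoint δ '' (Λ δ).zdABEdges =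
      {(familyFaceDomain hΛ hadm).pt 0, (familyFaceDomain hΛ hadm).pt 1} := by
  have hδ : (Λ δ).δ = δ := hΛ.δ_eq δ
  have h0 : (familyFaceDomain hΛ hadm).pt 0 =
      medialPoint δ (cSrc (DiscreteDobrushin.startCorner hadm)) := by
    have := DiscreteDobrushin.faceDomain_pt_zero hadm (regular_of_zdDiscretisationFamily hΛ δ).1
      (regular_of_zdDiscretisationFamily hΛ δ).2.1 (regular_of_zdDiscretisationFamily hΛ δ).2.2.1
      (regular_of_zdDiscretisationFamily hΛ δ).2.2.2
    rw [hδ] at this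
    exact this
  have h1 : (familyFaceDomain hΛ hadm).pt 1 =
      medialPoint δ (cSrc (DiscreteDobrushin.ebDart hadm)) := by
    have := DiscreteDobrushin.faceDomain_pt_one hadm (regular_of_zdDiscretisationFamily hΛ δ).1
      (regular_of_zdDiscretisationFamily hΛ δ).2.1 (regular_of_zdDiscretisationFamily hΛ δ).2.2.1
      (regular_of_zdDiscretisationFamily hΛ δ).2.2.2
    rw [hδ] at this
    exact this
  have hea := DiscreteDobrushin.cSrc_startCorner_mem hadm
  have heb : cSrc (DiscreteDobrushin.ebDart hadm) ∈ (Λ δ).zdABEdges := by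
    rw [← DiscreteDobrushin.ebDart'_eq_ebDart hadm ∅]
    exact DiscreteDobrushin.cSrc_ebDart'_mem hadm ∅
  have hne : cSrc (DiscreteDobrushin.ebDart hadm) ≠
      cSrc (DiscreteDobrushin.startCorner hadm) := by
    rw [← DiscreteDobrushin.ebDart'_eq_ebDart hadm ∅]
    exact DiscreteDobrushin.cSrc_ebDart'_ne hadm ∅
  rw [h0, h1]
  apply Set.Subset.antisymm
  · rintro _ ⟨e, he, rfl⟩
    by_cases hea' : e = cSrc (DiscreteDobrushin.startCorner hadm)
    · exact Or.inl (by rw [hea'])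
    · have := DiscreteDobrushin.eq_of_mem_zdABEdges_of_ne hadm he heb hea' hne
      exact Or.inr (by rw [this]; rfl)
  · rintro x (rfl | rfl)
    · exact ⟨_, hea, rfl⟩
    · exact ⟨_, heb, rfl⟩

/-- Near a two-point set in the Hausdorff sense: every point of `s` is within `ε` of `x` or of
`y`, and each of `x`, `y` is within `ε` of some point of `s`. [folklore] -/
theorem near_pair_of_hausdorffEDist_lt {s : Set ℂ} {x y : ℂ} {ε : ℝ}
    (h : hausdorffEDist s {x, y} < ENNReal.ofReal ε) :
    (∀ z ∈ s, dist z x < ε ∨ dist z y < ε) ∧ (∃ z ∈ s, dist x z < ε) ∧ ∃ z ∈ s, dist y z < ε := by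
  refine ⟨fun z hz ↦ ?_, ?_, ?_⟩
  · have h1 : infEDist z {x, y} < ENNReal.ofReal ε :=
      (infEDist_le_hausdorffEDist_of_mem hz).trans_lt h
    obtain ⟨w, hw, hzw⟩ := infEDist_lt_iff.1 h1
    rw [edist_lt_ofReal] at hzw
    rcases hw with rfl | rfl
    · exact Or.inl hzw
    · exact Or.inr (by simpa using hzw)
  · have h1 : infEDist x s < ENNReal.ofReal ε :=
      (infEDist_le_hausdorffEDist_of_mem (by simp : x ∈ ({x, y} : Set ℂ))).trans_lt
        (by rwa [hausdorffEDist_comm])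
    obtain ⟨w, hw, hxw⟩ := infEDist_lt_iff.1 h1
    exact ⟨w, hw, by rwa [edist_lt_ofReal] at hxw⟩
  · have h1 : infEDist y s < ENNReal.ofReal ε :=
      (infEDist_le_hausdorffEDist_of_mem (by simp : y ∈ ({x, y} : Set ℂ))).trans_lt
        (by rwa [hausdorffEDist_comm])
    obtain ⟨w, hw, hyw⟩ := infEDist_lt_iff.1 h1
    exact ⟨w, hw, by rwa [edist_lt_ofReal] at hyw⟩

/-- **The marked points of the oriented face domains converge: `pt 0 → a`, `pt 1 → b`** along
every sequence of positive admissible meshes `δ_k → 0` of a discretisation family. The family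
axiom `tendsto_zdABEdges` gives the convergence of `{a_δ, b_δ}` to `{a, b}` in Hausdorff
distance; since `a ≠ b`, for small `δ` one of `a_δ, b_δ` is near `a` and the other near `b`, and
the endpoint rule defining `orientedFaceDomain` puts the one near `a` first. These are the inputs
`ha`, `hb` of `MarkedDomain.exists_uniformizers_of_kernel(_of_isChordalUniformizing)` and `hb`
of `ae_isLoewnerDescribable_and_tendstoInDistribution_drivingPath_varying` (KS Cor. 1.8) for
these domains. [cite: KemppainenSmirnov2017, Cor. 1.8] -/
theorem tendsto_pt_orientedFaceDomain (hΛ : ZdDiscretisationFamily D Λ) {δs : ℕ → ℝ}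
    (hpos : ∀ k, 0 < δs k) (hlim : Tendsto δs atTop (𝓝 0))
    (hadm : ∀ k, (Λ (δs k)).IsZdAdmissible) :
    Tendsto (fun k ↦ (orientedFaceDomain hΛ (hadm k)).pt 0) atTop (𝓝 (D.pt 0)) ∧
      Tendsto (fun k ↦ (orientedFaceDomain hΛ (hadm k)).pt 1) atTop (𝓝 (D.pt 1)) := by
  set a : ℂ := D.pt 0 with ha
  set b : ℂ := D.pt 1 with hb
  have hab : a ≠ b := fun h ↦ absurd (D.pt_injective h) (by decide)
  have hab' : 0 < dist a b := dist_pos.2 hab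
  -- the meshes tend to `0` from the right
  have hlim' : Tendsto δs atTop (𝓝[>] 0) :=
    tendsto_nhdsWithin_iff.2 ⟨hlim, Eventually.of_forall hpos⟩
  have hH := hΛ.tendsto_zdABEdges.comp hlim'
  -- both marked points are eventually `ε`-close, for every small `ε`
  have key : ∀ ε : ℝ, 0 < ε → 4 * ε < dist a b → ∀ᶠ k in atTop,
      dist ((orientedFaceDomain hΛ (hadm k)).pt 0) a < ε ∧
        dist ((orientedFaceDomain hΛ (hadm k)).pt 1) b < ε := by
    intro ε hε hε4
    have hev : ∀ᶠ k in atTop, hausdorffEDist (medialPoint (δs k) '' (Λ (δs k)).zdABEdges) {a, b} <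
        ENNReal.ofReal ε := by
      have := (ENNReal.tendsto_nhds_zero.1 hH) (ENNReal.ofReal (ε / 2))
        (by simpa using half_pos hε)
      filter_upwards [this] with k hk
      exact lt_of_le_of_lt hk ((ENNReal.ofReal_lt_ofReal_iff hε).2 (by linarith))
    filter_upwards [hev] with k hk
    set F := familyFaceDomain hΛ (hadm k) with hF
    set p : ℂ := F.pt 0 with hp
    set q : ℂ := F.pt 1 with hq
    rw [medialPoint_image_zdABEdges_eq hΛ (hadm k)] at hk
    obtain ⟨hall, ⟨za, hza, haz⟩, ⟨zb, hzb, hbz⟩⟩ :=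
      near_pair_of_hausdorffEDist_lt hk
    have hp' := hall p (Or.inl rfl)
    have hq' := hall q (Or.inr rfl)
    by_cases hpa : dist p a < ε
    · -- `a_δ` is near `a`: no swap
      have hpb : ε < dist p b := by
        have := dist_triangle a p b
        rw [dist_comm a p] at this
        linarith
      have hle : dist p a ≤ dist p b := by linarith
      have hO : orientedFaceDomain hΛ (hadm k) = F := orientedFaceDomain_of_le hΛ (hadm k) hle
      rw [hO]
      refine ⟨hpa, ?_⟩
      -- `b` is near `p` or `q`; not near `p`
      rcases hzb with rfl | rfl
      · rw [dist_comm] at hbz; linarith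
      · rwa [dist_comm] at hbz
    · -- `a_δ` is near `b`: swap
      have hpb : dist p b < ε := (hp'.resolve_left hpa)
      have hpa' : ε < dist p a := by
        have := dist_triangle a p b
        rw [dist_comm a p] at this
        linarith
      have hlt : ¬ dist p a ≤ dist p b := by linarith
      have hO : orientedFaceDomain hΛ (hadm k) = F.swap := orientedFaceDomain_of_not_le hΛ (hadm k) hlt
      rw [hO, MarkedDomain.pt_swap_zero, MarkedDomain.pt_swap_one]
      refine ⟨?_, hpb⟩
      -- `a` is near `p` or `q`; not near `p`
      rcases hza with rfl | rfl
      · rw [dist_comm] at haz; linarith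
      · rwa [dist_comm] at haz
  have hε0 : 0 < dist a b / 8 := by positivity
  have hsmall : ∀ ε : ℝ, 4 * min ε (dist a b / 8) < dist a b := fun ε ↦ by
    have := min_le_right ε (dist a b / 8)
    linarith
  rw [Metric.tendsto_nhds, Metric.tendsto_nhds]
  refine ⟨fun ε hε ↦ ?_, fun ε hε ↦ ?_⟩
  · exact (key _ (lt_min hε hε0) (hsmall ε)).mono fun k hk ↦
      lt_of_lt_of_le hk.1 (min_le_left _ _)
  · exact (key _ (lt_min hε hε0) (hsmall ε)).mono fun k hk ↦
      lt_of_lt_of_le hk.2 (min_le_left _ _)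

end Literature.Probability.Percolation
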